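import Literature.NumberTheory.Automorphic.UnitaryGroupDualPairLocalLine
import Literature.NumberTheory.Automorphic.LocalUnitaryGroupCongr
import Literature.NumberTheory.GelbartRogawski1991.LocalUnitarySplittingDatum
import HarnessLib

/-!
# The CM DOCKING MATRIX of the line embedding `k ↦ k ⊗ 1` through the factor form and a local congruence
# (N3 road (S2)-b, input (i) of the abstract assembler part 3a — F0∕P2, crux H413)

Cell `hodgecm-mathlib`, F0∕P2, crux H413 (`stmt-HodgeConjecture-24833`); THEOREMS ONLY (no definition, no instance, no notation,
no named fact, no `sorry`).  A-p12 (g17)'s part 3a «abstract assembler» of the N3 road isolates the CM plumbing of the group element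
`g : Gqs L v = U(Φ₃)(L⁺_v)` acting in Liu's local theta type `X_v = xThetaGqsCM …` (★ `ThetaDichotomyVocabulary` :197–207:
`xThetaCM ∘ localPiEquiv⁻¹ ∘ cmDatumLocalCongr`, with `xThetaCM = (TwistedCoinv.rep χ ω hc) ∘ localLineInl`, ★ `CMThetaTypeVocabulary`
:101–113) into ONE matrix identity and ONE `reIm` formula:

* §1 (generic `E∕F`, `c`, `J_V`, `J_W`, `e : Fin N × Fin 1 ≃ Fin n`): the `GL_n(E ⊗ F_v)`-matrix of
  `localPiEquiv (localLineInl e J_V J_W v (localPiEquiv⁻¹ u))` is `reindexGL e (kroneckerGL (u, 1))`, i.e. `reindex e e (u ⊗ₖ 1)`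
  (`coe_localPiEquiv_localLineInl_localPiEquiv_symm`, matrix form `coe_coe_localPiEquiv_localLineInl_localPiEquiv_symm`), over the
  regrouping identity `localGLPiEquiv⁻¹ ∘ localLineGL e v ∘ localGLPiEquiv = reindexGL e ∘ kroneckerGL (·, 1)`
  (`localGLPiEquiv_symm_localLineGL_localGLPiEquiv`);
* §2 the symplectic side: `(iota … v k).1 (reIm x) = reIm ((localPiEquiv k : GL_n) *ᵥ x)` (★ `iota_def` + ★ `localToSymplectic_reIm`;
  `iota_fst_reIm`), hence for `k := localLineInl (localPiEquiv⁻¹ u)`: `… = reIm (reindex e e (u ⊗ₖ 1) *ᵥ x)`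
  (`iota_localLineInl_fst_reIm`);
* §3 the CM packaging (`F = L⁺`, `E = L`, `c` = complex conjugation, carriers `(cmDatum L N ·).Local v`, e.g. `Gqs L v`): with the local
  congruence ★ `cmDatumLocalCongr L v T ha h` (`g ↦ T g T⁻¹`) in front, the matrix is `reindexGL e (kroneckerGL (T * g.val * T⁻¹, 1))`
  (`coe_localPiEquiv_localLineInl_cmDatumLocalCongr`) and the `reIm` formula reads `reIm (reindex e e ((T g T⁻¹) ⊗ₖ 1) *ᵥ x)`
  (`iota_localLineInl_cmDatumLocalCongr_fst_reIm`) — the `hι` hypothesis of part 3a at `M g := reindexGL e (kroneckerGL (T * g.val * T⁻¹, 1))`.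

Everything is entrywise bookkeeping over ★ `GLn.piEquiv` (`coe_piEquiv_symm_apply`, `rfl`), ★ `coe_localLineGL_apply`, ★ `coe_reindexGL`,
★ `coe_kroneckerGL`, ★ `coe_cmDatumLocalCongr_apply` (`rfl`); no published theorem is a hypothesis.  HC_CM is proved only modulo the printed
citations until rung 0 closes; this file introduces no debt.

## References
* [MoeglinVignerasWaldspurger1987] C. Mœglin, M.-F. Vignéras, J.-L. Waldspurger, LNM 1291 (1987), Chap. 1 I.17 (dual pairs, `g ↦ g ⊗ 1`).
* [GelbartRogawski1991] S. Gelbart, J. Rogawski, Invent. Math. 105 (1991), §3.2 p. 457 (`a : U(V) → G₁`).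
* [PlatonovRapinchuk1994] V. Platonov, A. Rapinchuk, *Algebraic Groups and Number Theory* (1994), §2.3 (congruent forms), §5.1 (`G_{F_v}`).
-/

set_option autoImplicit false
set_option linter.dupNamespace false

noncomputable section

open scoped Matrix Kronecker MatrixGroups
open NumberField IsDedekindDomain

namespace Summit.HodgeConjecture.HodgeConjecture.Cruxes.H413.F0P2oCmLineDockingMatrix

open Literature.NumberTheory.Automorphic Literature.NumberTheory.Automorphic.UnitaryGroup
open Literature.NumberTheory.GelbartRogawski1991.UnitaryDualPair.LocalSplitting

/-! ## §1 The matrix of `localPiEquiv ∘ localLineInl ∘ localPiEquiv⁻¹` is `reindex e (u ⊗ 1)` -/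

section Generic

variable {F : Type} (E : Type) [Field F] [NumberField F] [Field E] [NumberField E] [Algebra F E]
variable (c : E ≃ₐ[F] E) (N : ℕ) {n : ℕ} (e : Fin N × Fin 1 ≃ Fin n)
variable (JV : Matrix (Fin N) (Fin N) E) (JW : Matrix (Fin 1) (Fin 1) E) (v : HeightOneSpectrum (𝓞 F))

omit [NumberField F] in
/-- **Regrouping identity**: `localGLPiEquiv⁻¹ (localLineGL e v (localGLPiEquiv g)) = reindexGL e (kroneckerGL (g, 1))` in `GL_n(E ⊗ F_v)` —
entry `(a, b)` at the place `w` is `g_{(e⁻¹a)₁ (e⁻¹b)₁, w} · 1_{(e⁻¹a)₂ (e⁻¹b)₂}` on both sides. [cite: MoeglinVignerasWaldspurger1987, Chap. 1 I.17] -/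
theorem localGLPiEquiv_symm_localLineGL_localGLPiEquiv (g : GL (Fin N) (LocalRing E v)) :
    (localGLPiEquiv E n v).symm (localLineGL E N e v (localGLPiEquiv E N v g)) = reindexGL e (kroneckerGL (g, 1)) := by
  refine Units.ext (Matrix.ext fun a b => funext fun w => ?_)
  rw [show ((localGLPiEquiv E n v).symm (localLineGL E N e v (localGLPiEquiv E N v g))).val a b w =
        (localLineGL E N e v (localGLPiEquiv E N v g) w).val a b from GLn.coe_piEquiv_symm_apply _ _ _ a b w,
    coe_localLineGL_apply, coe_reindexGL, coe_kroneckerGL, Units.val_one, GLn.coe_piEquiv_apply]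
  simp only [Matrix.reindex_apply, Matrix.submatrix_apply, Matrix.kroneckerMap_apply, Matrix.map_apply, Pi.evalRingHom_apply,
    Pi.mul_apply, Matrix.one_apply, Subsingleton.elim (e.symm a).2 (e.symm b).2, if_true, Pi.one_apply]

/-- **The matrix of `k ↦ k ⊗ 1` through the factor form**: for `u ∈ U(J_V)(F_v)` (matrix form `«local»`), the `GL_n(E ⊗ F_v)`-element under
`localPiEquiv (localLineInl e J_V J_W v (localPiEquiv⁻¹ u))` is `reindexGL e (kroneckerGL (u, 1))`. [cite: GelbartRogawski1991, §3.2 p. 457] -/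
theorem coe_localPiEquiv_localLineInl_localPiEquiv_symm (u : «local» E c N JV v) :
    ((localPiEquiv E c n (Matrix.reindex e e (JV ⊗ₖ JW)) v
          (localLineInl E c N e JV JW v ((localPiEquiv E c N JV v).symm u)) :
        «local» E c n (Matrix.reindex e e (JV ⊗ₖ JW)) v) : GL (Fin n) (LocalRing E v)) =
      reindexGL e (kroneckerGL ((u : GL (Fin N) (LocalRing E v)), 1)) := by
  rw [coe_localPiEquiv_apply, coe_localLineInl, coe_localPiEquiv_symm_apply]
  exact localGLPiEquiv_symm_localLineGL_localGLPiEquiv E N e v (u : GL (Fin N) (LocalRing E v))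

/-- Matrix form: `reindex e e (u ⊗ₖ 1)`. [cite: GelbartRogawski1991, §3.2 p. 457] -/
theorem coe_coe_localPiEquiv_localLineInl_localPiEquiv_symm (u : «local» E c N JV v) :
    ((localPiEquiv E c n (Matrix.reindex e e (JV ⊗ₖ JW)) v
          (localLineInl E c N e JV JW v ((localPiEquiv E c N JV v).symm u)) :
        «local» E c n (Matrix.reindex e e (JV ⊗ₖ JW)) v) : GL (Fin n) (LocalRing E v)).val =
      Matrix.reindex e e ((u : GL (Fin N) (LocalRing E v)).val ⊗ₖ (1 : Matrix (Fin 1) (Fin 1) (LocalRing E v))) := by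
  rw [coe_localPiEquiv_localLineInl_localPiEquiv_symm, coe_reindexGL, coe_kroneckerGL, Units.val_one]

/-! ## §2 The symplectic side: `ι_v k (reIm x) = reIm ((localPiEquiv k) x)` -/

variable [Algebra.IsQuadraticExtension F E] {δ : E} (hcδ : c δ = -δ) (hδ : δ ≠ 0) {d : F} (hd : δ * δ = algebraMap F E d)

/-- **`ι_v` on `reIm`-coordinates**: `(iota … v k).1 (reIm x) = reIm ((localPiEquiv k : GL_n(E ⊗ F_v)) *ᵥ x)` (★ `iota_def`: `iota = localPiToSymplectic =
localToSymplectic ∘ localPiEquiv`; ★ `localToSymplectic_reIm`). [cite: MoeglinVignerasWaldspurger1987, Chap. 1 I.17] -/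
theorem iota_fst_reIm {M : ℕ} (T : Matrix (Fin M) (Fin M) F) (hT : T.IsSymm) {J : Matrix (Fin M) (Fin M) E} (hJ : J = T.map (algebraMap F E))
    (k : localPi E c M J v) (x : Fin M → LocalRing E v) :
    (iota F E c M hcδ hδ hd T hT hJ v k).1
        (QuadraticCoordinates.reIm (quadraticLocalEquiv E v c hcδ hδ).toLinearEquiv.toAddEquiv (Fin M) x) =
      QuadraticCoordinates.reIm (quadraticLocalEquiv E v c hcδ hδ).toLinearEquiv.toAddEquiv (Fin M)
        (((localPiEquiv E c M J v k : «local» E c M J v) : GL (Fin M) (LocalRing E v)).val *ᵥ x) := by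
  rw [iota_def]
  exact localToSymplectic_reIm E c M v hcδ hδ hd hT hJ (localPiEquiv E c M J v k) x

/-- **`ι_v (k ⊗ 1)` on `reIm`-coordinates**: for `u ∈ U(J_V)(F_v)` and the big Gram data `(T, hT, hJ)` of `J_V ⊗ J_W = reindex e e (J_V ⊗ₖ J_W)`,
`(iota … v (localLineInl (localPiEquiv⁻¹ u))).1 (reIm x) = reIm (reindex e e (u ⊗ₖ 1) *ᵥ x)`. [cite: GelbartRogawski1991, §3.2 p. 457] -/
theorem iota_localLineInl_fst_reIm (T : Matrix (Fin n) (Fin n) F) (hT : T.IsSymm)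
    (hJ : Matrix.reindex e e (JV ⊗ₖ JW) = T.map (algebraMap F E)) (u : «local» E c N JV v) (x : Fin n → LocalRing E v) :
    (iota F E c n hcδ hδ hd T hT hJ v (localLineInl E c N e JV JW v ((localPiEquiv E c N JV v).symm u))).1
        (QuadraticCoordinates.reIm (quadraticLocalEquiv E v c hcδ hδ).toLinearEquiv.toAddEquiv (Fin n) x) =
      QuadraticCoordinates.reIm (quadraticLocalEquiv E v c hcδ hδ).toLinearEquiv.toAddEquiv (Fin n)
        (Matrix.reindex e e ((u : GL (Fin N) (LocalRing E v)).val ⊗ₖ (1 : Matrix (Fin 1) (Fin 1) (LocalRing E v))) *ᵥ x) := by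
  rw [iota_fst_reIm, coe_coe_localPiEquiv_localLineInl_localPiEquiv_symm]

end Generic

/-! ## §3 The CM packaging: a local congruence `g ↦ T g T⁻¹` in front (`Gqs L v → U(diag dV)(L⁺_v) → …`) -/

section CM

variable (L : Type) [Field L] [NumberField L] [IsCMField L] {N n : ℕ} (e : Fin N × Fin 1 ≃ Fin n)
variable {H H' : Matrix (Fin N) (Fin N) L} (JW : Matrix (Fin 1) (Fin 1) L) (v : HeightOneSpectrum (𝓞 ↥(maximalRealSubfield L)))
variable (T : GL (Fin N) (LocalRing L v)) {a : LocalRing L v} (ha : IsUnit a)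
variable (h : formCongr (conjLocal L (IsCMField.complexConj L) v) T (H.map (algebraMap L (LocalRing L v))) =
  a • H'.map (algebraMap L (LocalRing L v)))

/-- **CM DOCKING MATRIX**: for `g ∈ U(H′)(L⁺_v)` (e.g. `g : Gqs L v`) transported by the local congruence `cmDatumLocalCongr L v T ha h : U(H′)(L⁺_v) ≃ U(H)(L⁺_v)`
(`g ↦ T g T⁻¹`) and embedded by `k ↦ k ⊗ 1` through the factor form, the resulting `GL_n(L ⊗ L⁺_v)`-element is `reindexGL e (kroneckerGL (T * g.val * T⁻¹, 1))`.
[cite: PlatonovRapinchuk1994, §2.3] [cite: GelbartRogawski1991, §3.2 p. 457] -/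
theorem coe_localPiEquiv_localLineInl_cmDatumLocalCongr (g : (cmDatum L N H').Local v) :
    ((localPiEquiv L (IsCMField.complexConj L) n (Matrix.reindex e e (H ⊗ₖ JW)) v
          (localLineInl L (IsCMField.complexConj L) N e H JW v
            ((localPiEquiv L (IsCMField.complexConj L) N H v).symm (cmDatumLocalCongr L v T ha h g))) :
        «local» L (IsCMField.complexConj L) n (Matrix.reindex e e (H ⊗ₖ JW)) v) : GL (Fin n) (LocalRing L v)) =
      reindexGL e (kroneckerGL (T * g.val * T⁻¹, 1)) := by
  rw [coe_localPiEquiv_localLineInl_localPiEquiv_symm]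
  rfl

/-- Matrix form of the CM docking matrix: `reindex e e ((T g T⁻¹) ⊗ₖ 1)`. [cite: PlatonovRapinchuk1994, §2.3] -/
theorem coe_coe_localPiEquiv_localLineInl_cmDatumLocalCongr (g : (cmDatum L N H').Local v) :
    ((localPiEquiv L (IsCMField.complexConj L) n (Matrix.reindex e e (H ⊗ₖ JW)) v
          (localLineInl L (IsCMField.complexConj L) N e H JW v
            ((localPiEquiv L (IsCMField.complexConj L) N H v).symm (cmDatumLocalCongr L v T ha h g))) :
        «local» L (IsCMField.complexConj L) n (Matrix.reindex e e (H ⊗ₖ JW)) v) : GL (Fin n) (LocalRing L v)).val =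
      Matrix.reindex e e ((T * g.val * T⁻¹).val ⊗ₖ (1 : Matrix (Fin 1) (Fin 1) (LocalRing L v))) := by
  rw [coe_localPiEquiv_localLineInl_cmDatumLocalCongr, coe_reindexGL, coe_kroneckerGL, Units.val_one]

variable [Algebra.IsQuadraticExtension (↥(maximalRealSubfield L)) L] {δ : L} (hcδ : IsCMField.complexConj L δ = -δ) (hδ : δ ≠ 0)
  {d : ↥(maximalRealSubfield L)} (hd : δ * δ = algebraMap (↥(maximalRealSubfield L)) L d)

/-- **The `hι` hypothesis of the abstract assembler at the CM data**: for the big Gram data `(T′, hT′, hJ′)` of `H ⊗ J_W = reindex e e (H ⊗ₖ J_W)`,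
`(iota … v (localLineInl (localPiEquiv⁻¹ (cmDatumLocalCongr … g)))).1 (reIm x) = reIm (reindex e e ((T g T⁻¹) ⊗ₖ 1) *ᵥ x)`.
[cite: MoeglinVignerasWaldspurger1987, Chap. 1 I.17] [cite: PlatonovRapinchuk1994, §2.3] -/
theorem iota_localLineInl_cmDatumLocalCongr_fst_reIm (T' : Matrix (Fin n) (Fin n) ↥(maximalRealSubfield L)) (hT' : T'.IsSymm)
    (hJ' : Matrix.reindex e e (H ⊗ₖ JW) = T'.map (algebraMap (↥(maximalRealSubfield L)) L)) (g : (cmDatum L N H').Local v)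
    (x : Fin n → LocalRing L v) :
    (iota (↥(maximalRealSubfield L)) L (IsCMField.complexConj L) n hcδ hδ hd T' hT' hJ' v
          (localLineInl L (IsCMField.complexConj L) N e H JW v
            ((localPiEquiv L (IsCMField.complexConj L) N H v).symm (cmDatumLocalCongr L v T ha h g)))).1
        (QuadraticCoordinates.reIm (quadraticLocalEquiv L v (IsCMField.complexConj L) hcδ hδ).toLinearEquiv.toAddEquiv (Fin n) x) =
      QuadraticCoordinates.reIm (quadraticLocalEquiv L v (IsCMField.complexConj L) hcδ hδ).toLinearEquiv.toAddEquiv (Fin n)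
        (Matrix.reindex e e ((T * g.val * T⁻¹).val ⊗ₖ (1 : Matrix (Fin 1) (Fin 1) (LocalRing L v))) *ᵥ x) := by
  rw [iota_fst_reIm, coe_coe_localPiEquiv_localLineInl_cmDatumLocalCongr]

end CM

end Summit.HodgeConjecture.HodgeConjecture.Cruxes.H413.F0P2oCmLineDockingMatrix

end
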